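/-
Copyright (c) 2026. All rights reserved.
Released under Apache 2.0 license as described in the file LICENSE.
Authors: abc-iut cell, wave-6 cone prover seat abc-iut-w6-d025 (gen 4; row «PROP58vii-ARC-GENUINE», file 1/2), over
abc-iut-w6-d034's `TMMono.Iso.exists_sign`, abc-iut-w4-d020's chart construction (p411667), abc-iut-L6-d6's
`TMMonoGroupoid`, abc-iut-L4-t3's `TBPlus` and abc-iut-w4-d095's `TBPlusCategory` (census brick m1).
-/
import Literature.AnabelianGeometry.AbsoluteAnabelian.MonoAnalyticArchFunctorialProofs
import Literature.AnabelianGeometry.AbsoluteAnabelian.TMMonoGroupoid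
import Literature.AnabelianGeometry.AbsoluteAnabelian.TBPlusCategory
import Mathlib.Topology.Instances.AddCircle.Defs
import HarnessLib

/-!
# [AbsTopIII] Prop 5.8 (iv)/(v): the algorithm `G ↦ Γ⃗×_arc(G)` as a FUNCTOR `TM⊢ ⥤ TB⊞` (census brick m2)

S. Mochizuki, *Topics in absolute anabelian geometry III*, J. Math. Sci. Univ. Tokyo 22 (2015) [MochizukiAbsTopIII2015];
manuscript `paper:url-5493eb38cbb7`, read on the page (own render): Prop 5.8 (iv) p. 140 l. 28–40 ("Let `G = (C, C⃗)
∈ Ob(TM⊢)`; write `C∼ → C×` for the [pointed] universal covering of `C×` … regard `C∼` as a topological group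
[isomorphic to `ℝ`]. Then the evident isomorphism `Lie±(C∼) ≅ Lie±(C×)` allows one to regard `k∼(G) := C∼ × C∼`,
`k×(G) := C× × C∼` as objects of `TB⊞`"), (v) p. 140 l. 41 – p. 141 l. 1 ("The constructions of (iv) yield a functorial
[i.e., relative to `TM⊢`] algorithm `Ob(TM⊢) ∋ G ↦ Γ⃗×_arc(G)` for constructing from `G` the `Γ⃗×_arc`-diagram in
`𝒞^{hol⊢}_{TB⊞}` `k∼(G) = C∼ × C∼ ↠ k×(G) = C× × C∼`"), Def 5.6 (i) p. 134 (`TM⊢`, `TB⊞`).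

The tree holds the OUTPUT of Prop 5.8 (iv)–(vi) at one `G` in a chosen chart `e : C ≅ 𝒪^▷_ℂ` (`C∼ := ℝ`, covering
`t ↦ e⁻¹(e^{it})`; `TMMono.exists_monoAnalyticArch_isNormalized`, abc-iut-w4-d020) and the functoriality DATUM
`TMMono.Iso.exists_sign` (abc-iut-w6-d034: a morphism of `TM⊢` lifts to `t ↦ σt`, `σ = ±1`), but no functor.  Here
(cell row «PROP58vii-ARC-GENUINE», abc-iut-w4-d095's census bricks m2 over m1 = `Category TBPlus`):
* §1 `TMMono.chart G` (THE chart, chosen once per `G` inside the definition), `TMMono.cover G : C∼ = ℝ → C`, the SIGN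
  `TMMono.sign φ ∈ {±1}` of a morphism `φ` of `TM⊢` with its UNIQUENESS (`sign_eq_of_forall`), hence the functor laws
  `sign_id`, `sign_comp` — PROVED, not assumed (print: the universal covering is canonical up to exactly this sign);
* §2 `TMMono.kTilde`, `TMMono.kTimes : TMMono ⥤ TBPlus` — `k∼(G) = C∼ × C∼` (`B′ = C∼ × 0`, `B″ = 0 × C∼`, `β = 1` = "the
  evident isomorphism `Lie±(C∼) ≅ Lie±(C×)`": both factors are the line `C∼`) and `k×(G) = C× × C∼` (`B′ = C×`
  PARAMETRISED BY THE COVERING `C∼ ↠ C×` of period `F = 2π`, `B″ = C∼`), a morphism `φ` acting by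
  `(s, t) ↦ (σ_φ s, σ_φ t)` (rescalings `a₁ = a₂ = σ_φ`; `kTimes_map_a₁_cover`: on `C×` this IS `φ` read in the charts);
  the arrow `k∼(G) ↠ k×(G)` (covering × identity) as a NATURAL TRANSFORMATION `TMMono.gammaArc : kTilde ⟶ kTimes`.
Carriers are `ULift`-ed to the ambient universe (the §5 interface wants large categories).  File 2/2
(`LogFrobeniusArchGenuineMonoAn.lean`) builds print's `An⊢[𝒩⊢⊞_w]` for `w ∈ W_arc` and the §5 setting on top.
MODEL-LEVEL bookkeeping of refereed pre-IUT material; classical covering-space facts as proved in the tree; nothing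
here bears on [IUTchIII] Cor. 3.12; no side taken; typed ≠ proved elsewhere.
-/

set_option autoImplicit false

noncomputable section

open CategoryTheory Topology Complex

universe v u

namespace Literature.AnabelianGeometry.AbsoluteAnabelian

/-! ## §1. The chart, the covering coordinate `C∼ = ℝ → C`, and the sign of a morphism of `TM⊢` -/

namespace TMMono

variable (M : TMMono.{v})
/-- THE chart `e_G : C ⥲ 𝒪^▷_ℂ` of `G = (C, C⃗)` (Def 5.6 (i): `C` is isomorphic to `𝒪^▷_ℂ`), chosen once; the only
non-canonical ingredient of the tree's Prop 5.8 (iv) construction. [cite: MochizukiAbsTopIII2015, Prop 5.8 (iv) p.140] -/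
def chart : M.C ≃* complexIntegralMonoid := Classical.choose M.exists_iso
/-- The chart is continuous. [cite: MochizukiAbsTopIII2015, Def 5.6 (i) p.134] -/
theorem continuous_chart : Continuous M.chart := (Classical.choose_spec M.exists_iso).1
/-- The inverse chart is continuous. [cite: MochizukiAbsTopIII2015, Def 5.6 (i) p.134] -/
theorem continuous_chart_symm : Continuous M.chart.symm := (Classical.choose_spec M.exists_iso).2
/-- The point `e^{it} ∈ 𝒪^▷_ℂ`. [cite: MochizukiAbsTopIII2015, Prop 5.8 (iv) p.140] -/
def expPt (t : ℝ) : complexIntegralMonoid := ⟨Complex.exp (t * I), exp_mul_I_mem_complexIntegralMonoid t⟩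
/-- **The universal covering `C∼ → C×` in the chart**: `C∼ := ℝ`, `t ↦ e_G⁻¹(e^{it})` (the tree's Prop 5.8 (iv)
construction, abc-iut-w4-d020). [cite: MochizukiAbsTopIII2015, Prop 5.8 (iv) p.140] -/
def cover (t : ℝ) : M.C := M.chart.symm (expPt t)
/-- `t ↦ e^{it}` separates the two signs: if `e^{iσt} = e^{iσ't}` for all `t` with `σ, σ' ∈ {±1}` then `σ = σ'`
(evaluate at `t = π/2`: `i ≠ -i`). [cite: MochizukiAbsTopIII2015, Prop 5.8 (iv) p.140] -/
theorem sign_unique_aux {σ σ' : ℝ} (hσ : σ = 1 ∨ σ = -1) (hσ' : σ' = 1 ∨ σ' = -1)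
    (h : expPt (σ * (Real.pi / 2)) = expPt (σ' * (Real.pi / 2))) : σ = σ' := by
  have hmem : ∀ {τ : ℝ}, (τ = 1 ∨ τ = -1) → τ * (Real.pi / 2) ∈ Set.Ioo (-Real.pi) Real.pi := by
    intro τ hτ
    rcases hτ with rfl | rfl <;> constructor <;> nlinarith [Real.pi_pos]
  have h' : Complex.exp (↑(σ * (Real.pi / 2)) * I) = Complex.exp (↑(σ' * (Real.pi / 2)) * I) := congrArg Subtype.val h
  have := exp_mul_I_injOn (hmem hσ) (hmem hσ') h'
  have hpi : Real.pi / 2 ≠ 0 := by positivity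
  exact mul_right_cancel₀ hpi this

variable {M}
/-- Uniqueness of the sign at `G`: `e_G⁻¹(e^{iσt}) = e_G⁻¹(e^{iσ't})` for all `t` forces `σ = σ'`.
[cite: MochizukiAbsTopIII2015, Prop 5.8 (iv) p.140] -/
theorem sign_unique {σ σ' : ℝ} (hσ : σ = 1 ∨ σ = -1) (hσ' : σ' = 1 ∨ σ' = -1)
    (h : ∀ t : ℝ, M.cover (σ * t) = M.cover (σ' * t)) : σ = σ' :=
  sign_unique_aux hσ hσ' (M.chart.symm.injective (h (Real.pi / 2)))

variable {M₁ M₂ M₃ : TMMono.{v}}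
/-- **The sign `σ_φ ∈ {±1}` of a morphism `φ : G₁ → G₂` of `TM⊢`**: `φ` lifts to the isomorphism `t ↦ σ_φ·t` of the
universal coverings `C∼₁ → C∼₂` (abc-iut-w6-d034's `TMMono.Iso.exists_sign` at THE charts).
[cite: MochizukiAbsTopIII2015, Prop 5.8 (v) p.140] -/
def sign (φ : M₁ ⟶ M₂) : ℝ :=
  Classical.choose (TMMono.Iso.exists_sign φ M₁.chart M₁.continuous_chart M₁.continuous_chart_symm
    M₂.chart M₂.continuous_chart M₂.continuous_chart_symm)
/-- `σ_φ = ±1`. [cite: MochizukiAbsTopIII2015, Prop 5.8 (v) p.140] -/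
theorem sign_eq_one_or (φ : M₁ ⟶ M₂) : sign φ = 1 ∨ sign φ = -1 :=
  (Classical.choose_spec (TMMono.Iso.exists_sign φ M₁.chart M₁.continuous_chart M₁.continuous_chart_symm
    M₂.chart M₂.continuous_chart M₂.continuous_chart_symm)).1
/-- **`φ` lifts to `t ↦ σ_φ·t`**: `φ(e₁⁻¹(e^{it})) = e₂⁻¹(e^{iσ_φ t})`. [cite: MochizukiAbsTopIII2015, Prop 5.8 (v) p.140] -/
theorem map_cover (φ : M₁ ⟶ M₂) (t : ℝ) : φ.toMulEquiv (M₁.cover t) = M₂.cover (sign φ * t) :=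
  (Classical.choose_spec (TMMono.Iso.exists_sign φ M₁.chart M₁.continuous_chart M₁.continuous_chart_symm
    M₂.chart M₂.continuous_chart M₂.continuous_chart_symm)).2 t
/-- The sign is CHARACTERISED by the lifting property. [cite: MochizukiAbsTopIII2015, Prop 5.8 (v) p.140] -/
theorem sign_eq_of_forall (φ : M₁ ⟶ M₂) {σ' : ℝ} (hσ' : σ' = 1 ∨ σ' = -1)
    (h : ∀ t : ℝ, φ.toMulEquiv (M₁.cover t) = M₂.cover (σ' * t)) : sign φ = σ' :=
  sign_unique (sign_eq_one_or φ) hσ' fun t => by rw [← map_cover, h]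
/-- `σ_φ² = 1`. [cite: MochizukiAbsTopIII2015, Prop 5.8 (v) p.140] -/
theorem sign_mul_self (φ : M₁ ⟶ M₂) : sign φ * sign φ = 1 := by
  rcases sign_eq_one_or φ with h | h <;> rw [h] <;> norm_num
/-- **Functor law I**: `σ_{id} = 1`. [cite: MochizukiAbsTopIII2015, Prop 5.8 (v) p.140] -/
theorem sign_id (M : TMMono.{v}) : sign (𝟙 M) = 1 :=
  sign_eq_of_forall (𝟙 M) (Or.inl rfl) fun t => by rw [one_mul]; rfl
/-- **Functor law II**: `σ_{φ ≫ ψ} = σ_φ · σ_ψ`. [cite: MochizukiAbsTopIII2015, Prop 5.8 (v) p.140] -/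
theorem sign_comp (φ : M₁ ⟶ M₂) (ψ : M₂ ⟶ M₃) : sign (φ ≫ ψ) = sign φ * sign ψ := by
  refine sign_eq_of_forall (φ ≫ ψ) ?_ fun t => ?_
  · rcases sign_eq_one_or φ with h | h <;> rcases sign_eq_one_or ψ with h' | h' <;> rw [h, h'] <;> norm_num
  · change ψ.toMulEquiv (φ.toMulEquiv (M₁.cover t)) = _
    rw [map_cover, map_cover, ← mul_assoc, mul_comm (sign ψ)]
/-- The sign as an integer (for the `ℤ`-module action on the containers). [cite: MochizukiAbsTopIII2015, Prop 5.8 (v) p.140] -/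
def signZ (φ : M₁ ⟶ M₂) : ℤ := if sign φ = 1 then 1 else -1
/-- `(σ_φ : ℤ) = σ_φ` in `ℝ`. [cite: MochizukiAbsTopIII2015, Prop 5.8 (v) p.140] -/
theorem cast_signZ (φ : M₁ ⟶ M₂) : (signZ φ : ℝ) = sign φ := by
  unfold signZ
  rcases sign_eq_one_or φ with h | h
  · rw [if_pos h, h]; norm_num
  · rw [if_neg (by rw [h]; norm_num), h]; norm_num
/-- `σ_{id} = 1` in `ℤ`. [cite: MochizukiAbsTopIII2015, Prop 5.8 (v) p.140] -/
theorem signZ_id (M : TMMono.{v}) : signZ (𝟙 M) = 1 := by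
  unfold signZ; rw [if_pos (sign_id M)]
/-- `σ_{φ ≫ ψ} = σ_φ σ_ψ` in `ℤ`. [cite: MochizukiAbsTopIII2015, Prop 5.8 (v) p.140] -/
theorem signZ_comp (φ : M₁ ⟶ M₂) (ψ : M₂ ⟶ M₃) : signZ (φ ≫ ψ) = signZ φ * signZ ψ := by
  have h : (signZ (φ ≫ ψ) : ℝ) = (signZ φ * signZ ψ : ℤ) := by
    rw [Int.cast_mul, cast_signZ, cast_signZ, cast_signZ, sign_comp]
  exact_mod_cast h
/-- `σ_φ² = 1` in `ℤ`. [cite: MochizukiAbsTopIII2015, Prop 5.8 (v) p.140] -/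
theorem signZ_mul_self (φ : M₁ ⟶ M₂) : signZ φ * signZ φ = 1 := by
  have h : ((signZ φ * signZ φ : ℤ) : ℝ) = (1 : ℤ) := by
    rw [Int.cast_mul, cast_signZ, sign_mul_self, Int.cast_one]
  exact_mod_cast h


/-! ## §2. `Γ⃗×_arc(G)`: `k∼(G) = C∼ × C∼ ↠ k×(G) = C× × C∼` as FUNCTORS `TM⊢ ⥤ TB⊞` and a natural transformation -/

section Containers
/-- Multiplication by an integer `n` as a continuous endomorphism of a topological additive group (the action of the
sign `σ_φ = ±1` on the containers). [cite: MochizukiAbsTopIII2015, Prop 5.8 (v) p.140] -/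
def zsmulEnd (B : Type v) [AddCommGroup B] [TopologicalSpace B] [IsTopologicalAddGroup B] (n : ℤ) : B →ₜ+ B where
  toFun x := n • x
  map_zero' := smul_zero n
  map_add' x y := smul_add n x y
  continuous_toFun := continuous_zsmul n
/-- `zsmulEnd` on elements. [cite: MochizukiAbsTopIII2015, Prop 5.8 (v) p.140] -/
@[simp] theorem zsmulEnd_apply (B : Type v) [AddCommGroup B] [TopologicalSpace B] [IsTopologicalAddGroup B] (n : ℤ)
    (x : B) : zsmulEnd B n x = n • x := rfl
/-- The carrier `C∼ × C∼ = ℝ × ℝ` of `k∼(G)` in the covering coordinate (lifted to the ambient universe).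
[cite: MochizukiAbsTopIII2015, Prop 5.8 (iv) p.140] -/
abbrev TildeCarrier : Type v := ULift.{v} (ℝ × ℝ)
/-- The carrier `C× × C∼ = (ℝ/2πℤ) × ℝ` of `k×(G)` in the covering coordinate (`C× ≅ C∼/2πℤ`, `F = 2π`).
[cite: MochizukiAbsTopIII2015, Prop 5.8 (iv) p.140] -/
abbrev TimesCarrier : Type v := ULift.{v} (AddCircle (2 * Real.pi) × ℝ)
/-- `B′ = C∼ × 0 ⊆ k∼(G)`, parametrised: `s ↦ (s, 0)`. [cite: MochizukiAbsTopIII2015, Prop 5.8 (iv) p.140] -/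
def tildeC₁ : ℝ →ₜ+ TildeCarrier.{v} where
  toFun s := ULift.up (s, 0)
  map_zero' := rfl
  map_add' s t := congrArg ULift.up (by rw [Prod.mk_add_mk, add_zero])
  continuous_toFun := continuous_uliftUp.comp (continuous_id.prodMk continuous_const)
/-- `B″ = 0 × C∼ ⊆ k∼(G)`, parametrised: `t ↦ (0, t)`. [cite: MochizukiAbsTopIII2015, Prop 5.8 (iv) p.140] -/
def tildeC₂ : ℝ →ₜ+ TildeCarrier.{v} where
  toFun t := ULift.up (0, t)
  map_zero' := rfl
  map_add' s t := congrArg ULift.up (by rw [Prod.mk_add_mk, add_zero])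
  continuous_toFun := continuous_uliftUp.comp (continuous_const.prodMk continuous_id)
/-- `B′ = C× × 0 ⊆ k×(G)`, parametrised BY THE COVERING `C∼ ↠ C×`: `s ↦ (s mod 2π, 0)`.
[cite: MochizukiAbsTopIII2015, Prop 5.8 (iv) p.140] -/
def timesC₁ : ℝ →ₜ+ TimesCarrier.{v} where
  toFun s := ULift.up ((s : AddCircle (2 * Real.pi)), 0)
  map_zero' := congrArg ULift.up (by rw [AddCircle.coe_zero]; rfl)
  map_add' s t := congrArg ULift.up (by rw [AddCircle.coe_add, Prod.mk_add_mk, add_zero])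
  continuous_toFun := continuous_uliftUp.comp (continuous_quotient_mk'.prodMk continuous_const)
/-- `B″ = 0 × C∼ ⊆ k×(G)`, parametrised: `t ↦ (0, t)`. [cite: MochizukiAbsTopIII2015, Prop 5.8 (iv) p.140] -/
def timesC₂ : ℝ →ₜ+ TimesCarrier.{v} where
  toFun t := ULift.up (0, t)
  map_zero' := rfl
  map_add' s t := congrArg ULift.up (by rw [Prod.mk_add_mk, add_zero])
  continuous_toFun := continuous_uliftUp.comp (continuous_const.prodMk continuous_id)
/-- The shell arrow `k∼(G) ↠ k×(G)` = (covering `C∼ ↠ C×`) × (identity of `C∼`) on carriers.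
[cite: MochizukiAbsTopIII2015, Prop 5.8 (v) p.140] -/
def coverHom : TildeCarrier.{v} →ₜ+ TimesCarrier.{v} where
  toFun x := ULift.up ((x.down.1 : AddCircle (2 * Real.pi)), x.down.2)
  map_zero' := congrArg ULift.up (by
    change (((0 : ℝ) : AddCircle (2 * Real.pi)), (0 : ℝ)) = 0
    rw [AddCircle.coe_zero]; rfl)
  map_add' x y := congrArg ULift.up (by
    change ((((x.down.1 + y.down.1 : ℝ)) : AddCircle (2 * Real.pi)), x.down.2 + y.down.2) = _
    rw [AddCircle.coe_add, Prod.mk_add_mk])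
  continuous_toFun := continuous_uliftUp.comp
    ((continuous_quotient_mk'.comp (continuous_fst.comp continuous_uliftDown)).prodMk
      (continuous_snd.comp continuous_uliftDown))
/-- `coverHom` on elements. [cite: MochizukiAbsTopIII2015, Prop 5.8 (v) p.140] -/
@[simp] theorem coverHom_apply (x : TildeCarrier.{v}) :
    coverHom x = ULift.up ((x.down.1 : AddCircle (2 * Real.pi)), x.down.2) := rfl
/-- **`k∼(G) := C∼ × C∼` as an object of `TB⊞`** (Prop 5.8 (iv)): `B = C∼ × C∼`, `B′ = C∼ × 0`, `B″ = 0 × C∼`,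
`β = 1` ("the evident isomorphism `Lie±(C∼) ≅ Lie±(C×)`": the two factors are the SAME line `C∼`).
[cite: MochizukiAbsTopIII2015, Prop 5.8 (iv) p.140] -/
def kTildeObj : TBPlus.{v} where
  B := TildeCarrier.{v}
  c₁ := tildeC₁
  c₂ := tildeC₂
  exists_injOn := ⟨1, one_pos,
    fun s _ t _ h => (Prod.mk.inj (ULift.up_inj.1 h)).1,
    fun s _ t _ h => (Prod.mk.inj (ULift.up_inj.1 h)).2⟩
  add_injective s t h := by
    have hs : s = 0 := (Prod.mk.inj (ULift.up_inj.1 h)).1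
    subst hs; rfl
  add_surjective b := ⟨b.down, ULift.ext _ _ (by
    change (b.down.1, (0 : ℝ)) + (0, b.down.2) = b.down
    rw [Prod.mk_add_mk, add_zero, zero_add])⟩
  isOpenMap_add := by
    have h : (fun p : ℝ × ℝ => tildeC₁.{v} p.1 + tildeC₂.{v} p.2) = (Homeomorph.ulift.{v} (X := ℝ × ℝ)).symm := by
      funext p
      refine ULift.ext _ _ ?_
      change (p.1, (0 : ℝ)) + (0, p.2) = p
      rw [Prod.mk_add_mk, add_zero, zero_add]
    rw [h]
    exact (Homeomorph.ulift.{v} (X := ℝ × ℝ)).symm.isOpenMap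
  β := 1
  β_pos := one_pos
/-- **`k×(G) := C× × C∼` as an object of `TB⊞`** (Prop 5.8 (iv)): `B = C× × C∼`, `B′ = C×` parametrised by the covering
`C∼ ↠ C×` (period `F = 2π`), `B″ = C∼`, `β = 1`. [cite: MochizukiAbsTopIII2015, Prop 5.8 (iv) p.140] -/
def kTimesObj : TBPlus.{v} where
  B := TimesCarrier.{v}
  c₁ := timesC₁
  c₂ := timesC₂
  exists_injOn := by
    haveI : Fact (0 < 2 * Real.pi) := ⟨Real.two_pi_pos⟩
    refine ⟨Real.pi, Real.pi_pos, fun s hs t ht h => ?_, fun s _ t _ h => (Prod.mk.inj (ULift.up_inj.1 h)).2⟩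
    have h1 : (s : AddCircle (2 * Real.pi)) = t := (Prod.mk.inj (ULift.up_inj.1 h)).1
    have hI : ∀ {r : ℝ}, r ∈ Set.Ioo (-Real.pi) Real.pi → r ∈ Set.Ico (-Real.pi) (-Real.pi + 2 * Real.pi) :=
      fun hr => ⟨hr.1.le, by linarith [hr.2]⟩
    exact (AddCircle.coe_eq_coe_iff_of_mem_Ico (hI hs) (hI ht)).1 h1
  add_injective s t h := by
    have hs : (s : AddCircle (2 * Real.pi)) = 0 := (Prod.mk.inj (ULift.up_inj.1 h)).1
    refine ULift.ext _ _ ?_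
    change ((s : AddCircle (2 * Real.pi)), (0 : ℝ)) = 0
    rw [hs]; rfl
  add_surjective b := by
    obtain ⟨s, hs⟩ := QuotientAddGroup.mk_surjective b.down.1
    refine ⟨(s, b.down.2), ULift.ext _ _ ?_⟩
    change ((s : AddCircle (2 * Real.pi)), (0 : ℝ)) + (0, b.down.2) = b.down
    rw [Prod.mk_add_mk, add_zero, zero_add]
    exact Prod.ext hs rfl
  isOpenMap_add := by
    have h : (fun p : ℝ × ℝ => timesC₁.{v} p.1 + timesC₂.{v} p.2) =
        (Homeomorph.ulift.{v} (X := AddCircle (2 * Real.pi) × ℝ)).symm ∘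
          Prod.map (fun s : ℝ => (s : AddCircle (2 * Real.pi))) id := by
      funext p
      refine ULift.ext _ _ ?_
      change ((p.1 : AddCircle (2 * Real.pi)), (0 : ℝ)) + (0, p.2) = ((p.1 : AddCircle (2 * Real.pi)), p.2)
      rw [Prod.mk_add_mk, add_zero, zero_add]
    rw [h]
    have h1 : IsOpenMap (fun s : ℝ => (s : AddCircle (2 * Real.pi))) := QuotientAddGroup.isOpenMap_coe
    exact (Homeomorph.ulift.{v} (X := AddCircle (2 * Real.pi) × ℝ)).symm.isOpenMap.comp (h1.prodMap IsOpenMap.id)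
  β := 1
  β_pos := one_pos

variable {M₁ M₂ M₃ : TMMono.{v}}
/-- `σ_φ • (σ_φ • x) = x`: the sign acts by an involution. [cite: MochizukiAbsTopIII2015, Prop 5.8 (v) p.140] -/
theorem signZ_smul_signZ_smul {B : Type v} [AddCommGroup B] (φ : M₁ ⟶ M₂) (x : B) :
    signZ φ • signZ φ • x = x := by
  rw [smul_smul, signZ_mul_self, one_smul]
/-- **`k∼(φ)`**: a morphism `φ` of `TM⊢` acts on `k∼(G) = C∼ × C∼` by `(s, t) ↦ (σ_φ·s, σ_φ·t)` (the lift of `φ` to the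
universal coverings, on both factors); rescalings `a₁ = a₂ = σ_φ`. [cite: MochizukiAbsTopIII2015, Prop 5.8 (v) p.140] -/
def kTildeMap (φ : M₁ ⟶ M₂) : kTildeObj.{v} ⟶ kTildeObj.{v} where
  toHom := zsmulEnd TildeCarrier.{v} (signZ φ)
  surjective y := ⟨signZ φ • y, signZ_smul_signZ_smul φ y⟩
  a₁ := sign φ
  a₂ := sign φ
  map_c₁ s := by
    change signZ φ • ULift.up (s, (0 : ℝ)) = ULift.up (sign φ * s, 0)
    refine congrArg ULift.up ?_
    rw [Prod.smul_mk, smul_zero, zsmul_eq_mul, cast_signZ]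
  map_c₂ s := by
    change signZ φ • ULift.up ((0 : ℝ), s) = ULift.up (0, sign φ * s)
    refine congrArg ULift.up ?_
    rw [Prod.smul_mk, smul_zero, zsmul_eq_mul, cast_signZ]
  map_β := by
    change |sign φ| * 1 = 1 * |sign φ|
    rw [mul_one, one_mul]
/-- **`k×(φ)`**: `φ` acts on `k×(G) = C× × C∼` by `(z, t) ↦ (σ_φ·z, σ_φ·t)` (on `C× = C∼/2πℤ` this IS `φ|_{C×}` read in the
charts, by `map_cover`). [cite: MochizukiAbsTopIII2015, Prop 5.8 (v) p.140] -/
def kTimesMap (φ : M₁ ⟶ M₂) : kTimesObj.{v} ⟶ kTimesObj.{v} where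
  toHom := zsmulEnd TimesCarrier.{v} (signZ φ)
  surjective y := ⟨signZ φ • y, signZ_smul_signZ_smul φ y⟩
  a₁ := sign φ
  a₂ := sign φ
  map_c₁ s := by
    change signZ φ • ULift.up ((s : AddCircle (2 * Real.pi)), (0 : ℝ)) =
      ULift.up (((sign φ * s : ℝ) : AddCircle (2 * Real.pi)), 0)
    refine congrArg ULift.up ?_
    rw [Prod.smul_mk, smul_zero, ← cast_signZ, ← zsmul_eq_mul, AddCircle.coe_zsmul]
  map_c₂ s := by
    change signZ φ • ULift.up ((0 : AddCircle (2 * Real.pi)), s) = ULift.up (0, sign φ * s)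
    refine congrArg ULift.up ?_
    rw [Prod.smul_mk, smul_zero, zsmul_eq_mul, cast_signZ]
  map_β := by
    change |sign φ| * 1 = 1 * |sign φ|
    rw [mul_one, one_mul]
/-- **Prop 5.8 (iv)/(v): `G ↦ k∼(G)` is a FUNCTOR `TM⊢ ⥤ TB⊞`** ("functorial [i.e., relative to `TM⊢`]"): the laws are
`σ_{id} = 1`, `σ_{φ≫ψ} = σ_φ σ_ψ`. [cite: MochizukiAbsTopIII2015, Prop 5.8 (v) p.140] -/
def kTilde : TMMono.{v} ⥤ TBPlus.{v} where
  obj _ := kTildeObj.{v}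
  map φ := kTildeMap φ
  map_id M := by
    refine TBPlus.Hom.ext (ContinuousAddMonoidHom.ext fun x => ?_) (sign_id M) (sign_id M)
    change signZ (𝟙 M) • x = x
    rw [signZ_id, one_smul]
  map_comp φ ψ := by
    refine TBPlus.Hom.ext (ContinuousAddMonoidHom.ext fun x => ?_) ?_ ?_
    · change signZ (φ ≫ ψ) • x = signZ ψ • signZ φ • x
      rw [signZ_comp, smul_smul, mul_comm]
    · change sign (φ ≫ ψ) = sign ψ * sign φ
      rw [sign_comp, mul_comm]
    · change sign (φ ≫ ψ) = sign ψ * sign φ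
      rw [sign_comp, mul_comm]
/-- **Prop 5.8 (iv)/(v): `G ↦ k×(G)` is a FUNCTOR `TM⊢ ⥤ TB⊞`.** [cite: MochizukiAbsTopIII2015, Prop 5.8 (v) p.140] -/
def kTimes : TMMono.{v} ⥤ TBPlus.{v} where
  obj _ := kTimesObj.{v}
  map φ := kTimesMap φ
  map_id M := by
    refine TBPlus.Hom.ext (ContinuousAddMonoidHom.ext fun x => ?_) (sign_id M) (sign_id M)
    change signZ (𝟙 M) • x = x
    rw [signZ_id, one_smul]
  map_comp φ ψ := by
    refine TBPlus.Hom.ext (ContinuousAddMonoidHom.ext fun x => ?_) ?_ ?_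
    · change signZ (φ ≫ ψ) • x = signZ ψ • signZ φ • x
      rw [signZ_comp, smul_smul, mul_comm]
    · change sign (φ ≫ ψ) = sign ψ * sign φ
      rw [sign_comp, mul_comm]
    · change sign (φ ≫ ψ) = sign ψ * sign φ
      rw [sign_comp, mul_comm]
/-- The shell arrow `k∼(G) ↠ k×(G)` as a morphism of `TB⊞` (covering `×` identity; rescalings `1, 1`).
[cite: MochizukiAbsTopIII2015, Prop 5.8 (v) p.140] -/
def gammaArcApp : kTildeObj.{v} ⟶ kTimesObj.{v} where
  toHom := coverHom
  surjective y := by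
    obtain ⟨s, hs⟩ := QuotientAddGroup.mk_surjective y.down.1
    exact ⟨ULift.up (s, y.down.2), ULift.ext _ _ (Prod.ext hs rfl)⟩
  a₁ := 1
  a₂ := 1
  map_c₁ s := by
    change ULift.up (((s : ℝ) : AddCircle (2 * Real.pi)), (0 : ℝ)) = ULift.up (((1 * s : ℝ) : AddCircle (2 * Real.pi)), 0)
    rw [one_mul]
  map_c₂ s := by
    change ULift.up ((((0 : ℝ)) : AddCircle (2 * Real.pi)), s) = ULift.up ((0 : AddCircle (2 * Real.pi)), 1 * s)
    rw [one_mul, AddCircle.coe_zero]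
  map_β := by
    change |(1 : ℝ)| * 1 = 1 * |(1 : ℝ)|
    rw [mul_one, one_mul]
/-- **Prop 5.8 (v): `Γ⃗×_arc(G) = (k∼(G) ↠ k×(G))` is NATURAL in `G ∈ TM⊢`** — the arrow commutes with the action
`(s,t) ↦ (σ_φ s, σ_φ t)` of every morphism `φ` (the covering is a homomorphism). [cite: MochizukiAbsTopIII2015, Prop 5.8 (v) p.140] -/
def gammaArc : kTilde.{v} ⟶ kTimes.{v} where
  app _ := gammaArcApp.{v}
  naturality M₁ M₂ φ := by
    refine TBPlus.Hom.ext (ContinuousAddMonoidHom.ext fun x => ?_) ?_ ?_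
    · change coverHom (signZ φ • x) = signZ φ • coverHom x
      exact map_zsmul coverHom.{v} (signZ φ) x
    · change (1 : ℝ) * sign φ = sign φ * 1
      rw [one_mul, mul_one]
    · change (1 : ℝ) * sign φ = sign φ * 1
      rw [one_mul, mul_one]
/-- `gammaArc` at `G`, underlying map: `(s, t) ↦ (s mod 2π, t)`. [cite: MochizukiAbsTopIII2015, Prop 5.8 (v) p.140] -/
theorem gammaArc_app_toHom_apply (M : TMMono.{v}) (x : TildeCarrier.{v}) :
    (gammaArc.app M).toHom x = ULift.up ((x.down.1 : AddCircle (2 * Real.pi)), x.down.2) := rfl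
/-- `k∼(φ)` acts by the sign: underlying map `x ↦ σ_φ • x`. [cite: MochizukiAbsTopIII2015, Prop 5.8 (v) p.140] -/
theorem kTilde_map_toHom_apply (φ : M₁ ⟶ M₂) (x : TildeCarrier.{v}) : (kTilde.map φ).toHom x = signZ φ • x := rfl
/-- `k×(φ)` acts by the sign: underlying map `x ↦ σ_φ • x`. [cite: MochizukiAbsTopIII2015, Prop 5.8 (v) p.140] -/
theorem kTimes_map_toHom_apply (φ : M₁ ⟶ M₂) (x : TimesCarrier.{v}) : (kTimes.map φ).toHom x = signZ φ • x := rfl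
/-- **Link with `φ` itself**: the first coordinate of `k×(φ)` IS `φ|_{C×}` in the charts — `φ(e₁⁻¹(e^{is})) =
e₂⁻¹(e^{i·a₁(k×(φ))·s})`. [cite: MochizukiAbsTopIII2015, Prop 5.8 (v) p.140] -/
theorem kTimes_map_a₁_cover (φ : M₁ ⟶ M₂) (s : ℝ) : φ.toMulEquiv (M₁.cover s) = M₂.cover ((kTimes.map φ).a₁ * s) :=
  map_cover φ s

end Containers

end TMMono

end Literature.AnabelianGeometry.AbsoluteAnabelian

end
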